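import Literature.MathematicalPhysics.QuantumFieldTheory.Balaban1983to89.B9Cor38WholeRel

/-!
# `Balaban1983to89.B9Cor38WholeRelFaces` — Corollary 3.8 as the WHOLE PRINTED LEAF `B9.Cor38Printed` under the walk reading's
# RELATIVE support clause (`WalkReading.OKRel`), at both pinned data (`W38OfOps`, `W38OfOpsDir`), and the record-geometry faces
# (t37 ∧ c38 at `geo9Y`, (2.61) by `rowSum261_geo9Y`) — the `OKRel` twins of `B9Cor38Whole.cor38Printed_of_local342`,
# `B9Cor38WholeDir.cor38Printed_of_local342₂`, `B9RWSums347DefiniteFaces.thm37_cor38_W38OfOps_exp261_{of_rowSum261,geo9Y}` and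
# `B9Cor38WholeDir.thm37_cor38_W38OfOps_exp261_{of_rowSum261₂,geo9Y₂}`

T. Bałaban, *Propagators for lattice gauge theories in a background field*, Commun. Math. Phys. **99** (1985) 389–434
[`Balaban1985BackgroundPropagators`, "B9"], Cor. 3.8 (3.93)–(3.94) p. 410, Thm 3.7 (3.90) pp. 409–410, Cor. 3.6 p. 408; [4] = T. Bałaban,
*Propagators and renormalization transformations for lattice gauge theories. II*, Commun. Math. Phys. **96** (1984) 223–250
[`Balaban1984PropagatorsII`], Lemma 2.1 (2.59)–(2.61) pp. 233–234, (2.51)–(2.52) p. 232.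

statement-level skeleton of published theorems with citation tags; proofs where landed; nothing here is a claim about the
Yang–Mills mass gap

WHY THIS FILE (cell `pub-ymgap`, Track A node N06 [B9]; node00-def-Y RULING (A) on WORD-W1, bus l.42897; seat `pub-ymgap-dag-n06-c` g16).
`B9Cor38WholeRel` re-proves the one-member (3.94) bounds with the reading clauses relative to a block equivalence `Rel` (class
multiplicity ≦ m, d(·, b) saturated on classes), O(1) = m·B₀.  Here the family-level leaves follow VERBATIM the strict ones with
`hrd : ∀ i, (rd i).OKRel (𝔬 i).blk (Rel i)` and the package `Rel, m, hRd₂, hmult` (the binders already threaded through the `Rel`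
co-reading compositions `B9RWSumsCompleteGeo9YRel` ∕ `B9RWSumsDefinitePinsPairMDir3`): Corollary 3.8's existential O(1) is met with
max(m, 1)·B₀ (`walkFactor_le_walkFactor`); Theorem 3.7's half does not read the walk reading and is the existing theorem by name.
★ `cor38Printed_of_local342_okRel`, ★ `cor38Printed_of_local342₂_okRel`, `thm37_cor38_W38OfOps_exp261_of_rowSum261_okRel` ∕ `…₂_okRel`,
★ `thm37_cor38_W38OfOps_exp261_geo9Y_okRel` ∕ ★ `…₂_okRel`.

HONEST SCOPE.  Kernel bookkeeping; Corollary 3.6's blocks, the letters' structure, the sizes, (2.61) where displayed and the locality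
inputs are HYPOTHESES of printed shape; nothing of [B9] or [4] asserted; COUNT-NEUTRAL; N06 NOT discharged; one finite lattice
programme — nothing continuum, nothing about OS positivity or the mass gap.
-/

namespace Literature.MathematicalPhysics.QuantumFieldTheory.Balaban1983to89.B9Cor38WholeRelFaces

open Literature.MathematicalPhysics.QuantumFieldTheory.Balaban1983to89
open Finset B6RandomWalk B6RandomWalkHom B9Thm37Sum B9Thm34Ext B9Thm37Glue B9Thm37Whole B9Cor38Whole B9Cor38WholeDir
open B9RowSum261Faces B9RowSum261DefiniteFaces B9Ineq349Whole B9RWSums343to347Whole B9PinMembersKLevelV1 B9GeoLemma21KLevelV1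
open B9RWSums347DefiniteFaces B9RWSums346SecondDiff B9RWSums346SecondDiffGp B9Thm37WholeDir B9Thm37GlueDir B9Thm37KLetterDir
open B9Cor38WholeRel

noncomputable section

/-! ## §2 The family: Corollary 3.8 as the whole printed leaf under the relative reading clauses (both data) -/

section Family

variable {I : Type} {c35 : ℝ} {geo : I → B9.Geometry} {bg : I → B9.Backgrounds}
variable [∀ i, Fintype (geo i).Site] [∀ i, DecidableEq (geo i).Site]
variable {X Y ι Dir : I → Type} [∀ i, Fintype (X i)] [∀ i, DecidableEq (X i)] [∀ i, Fintype (Y i)]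
  [∀ i, DecidableEq (Y i)] [∀ i, Fintype (ι i)] [∀ i, Fintype (Dir i)]

omit [∀ i, Fintype (Y i)] [∀ i, DecidableEq (Y i)] [∀ i, Fintype (Dir i)] in
/-- ★ **COROLLARY 3.8 AS THE WHOLE PRINTED LEAF `B9.Cor38Printed`, RELATIVE READING CLAUSES** (`B9Cor38Whole.cor38Printed_of_local342`
with `hrd : ∀ i, (rd i).OKRel (𝔬 i).blk (Rel i)`, one block equivalence per member with class multiplicity ≦ m and d(·, b)
saturated on classes; p. 410, (3.94)): INHABITED at `W38OfOps (𝔬 i) (rd i) (R i) (H i) C δ` from Corollary 3.6's blocks for the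
G′_□(U) and the letters (`Local342 ∧ Identities`), the static data, the sizes, (2.61) at α for M ≧ M_L and the two locality inputs
(`Locality`); quantifiers met with M₂ := max(M₁, M_L), a₀ := a₁∕O(1), δ₀′ := 2(1 − α)δ₀, O(1) := max(m, 1)·B₀,
c := B₀e^{δ₀ρ}θ₀c₁(α) + 1.  Nothing of print asserted; NOT a node discharge.
[cite: Balaban1985BackgroundPropagators, Cor. 3.8 (3.93)–(3.94) p.410 + Cor. 3.6 p.408; Balaban1984PropagatorsII, Lemma 2.1 (2.61) p.234 + (2.51)–(2.52) p.232] -/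
theorem cor38Printed_of_local342_okRel (𝔬 : ∀ i, Ops (geo i) (bg i) (X i) (Y i) (ι i))
    (rd : ∀ i, WalkReading (geo i) (bg i) (X i) (ι i)) (R : I → ℝ) (H : I → Prop) (κ : I → Sizes) (C δ : ℝ)
    (d : ℕ) (α ρ N N' Cℓ K θ₀ B₀ δ₀ a₁ M₁ ML : ℝ)
    (Rel : ∀ i, (geo i).Site → (geo i).Site → Prop) [∀ i, DecidableRel (Rel i)] (m : ℕ)
    (hRd₂ : ∀ i (a b b' : (geo i).Site), Rel i b b' → (geo i).dist a b = (geo i).dist a b')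
    (hmult : ∀ i (y' : (geo i).Site), (Finset.univ.filter (fun y'' => Rel i y'' y')).card ≤ m)
    (hc : 0 < c35) (hα : 0 ≤ α) (hα1 : α < 1) (hθ₀ : 0 ≤ θ₀) (hB₀ : 0 < B₀) (hδ₀ : 0 < δ₀) (ha₁ : 0 < a₁)
    (hM₁ : 0 < M₁)
    (hst : ∀ i, StaticOK (𝔬 i) ρ N N' Cℓ (κ i)) (hκ : ∀ i, (κ i).Bounded K θ₀ Cℓ (geo i).M)
    (hrd : ∀ i, (rd i).OKRel (𝔬 i).blk (Rel i)) (hloc : ∀ i, Locality (𝔬 i) (rd i))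
    (h261 : ∀ i, ML ≤ (geo i).M → Ineq261 d (toB6 (geo i) (R i) (H i)) δ₀ α)
    (h36 : ∀ i, M₁ ≤ (geo i).M → ∀ α₀ : ℝ, 0 < α₀ → c35 * (geo i).M * α₀ ≤ a₁ →
      ∀ U : (bg i).Cfg, (bg i).Reg335 c35 α₀ U →
        Local342 (𝔬 i) (R i) (H i) B₀ δ₀ U ∧ Identities (𝔬 i) (R i) (H i) U) :
    B9.Cor38Printed c35 geo bg (fun i => W38OfOps (𝔬 i) (rd i) (R i) (H i) C δ) := by
  have hcpos : 0 < B₀ * Real.exp (δ₀ * ρ) * θ₀ * B6.c1 d δ₀ α + 1 := by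
    have h0 : 0 ≤ B₀ * Real.exp (δ₀ * ρ) * θ₀ * B6.c1 d δ₀ α :=
      mul_nonneg (mul_nonneg (mul_nonneg hB₀.le (Real.exp_nonneg _)) hθ₀) (c1_nonneg d δ₀ α)
    linarith
  have hmax : 0 < max (m : ℝ) 1 * B₀ := mul_pos (lt_of_lt_of_le one_pos (le_max_right _ _)) hB₀
  refine ⟨max M₁ ML, a₁ / c35, 2 * ((1 - α) * δ₀), max (m : ℝ) 1 * B₀, B₀ * Real.exp (δ₀ * ρ) * θ₀ * B6.c1 d δ₀ α + 1,
    lt_max_of_lt_left hM₁, div_pos ha₁ hc, by nlinarith, hmax, hcpos, ?_⟩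
  intro i hM α₀ hα₀ hMa U hU w lam y y' hfirst _hlast hlam
  have hM₁i : M₁ ≤ (geo i).M := le_trans (le_max_left _ _) hM
  have hMLi : ML ≤ (geo i).M := le_trans (le_max_right _ _) hM
  have hMpos : 0 < (geo i).M := lt_of_lt_of_le hM₁ hM₁i
  have ha : c35 * (geo i).M * α₀ ≤ a₁ := by
    have h1 : (geo i).M * α₀ * c35 ≤ a₁ := (le_div_iff₀ hc).mp hMa
    calc c35 * (geo i).M * α₀ = (geo i).M * α₀ * c35 := by ring
      _ ≤ a₁ := h1
  obtain ⟨hl, hi⟩ := h36 i hM₁i α₀ hα₀ ha U hU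
  refine ⟨locDep_W38OfOps (𝔬 i) (rd i) (R i) (H i) C δ (hloc i) U w, ?_⟩
  refine (term_W38OfOps_le_okRel (𝔬 i) (rd i) (R i) (H i) C δ d δ₀ α ρ B₀ N N' Cℓ θ₀ (κ i) U (Rel i) m (hRd₂ i)
    (hmult i) hB₀.le hδ₀.le hα hα1.le hθ₀ hMpos (hst i) (hκ i).nonneg (hκ i).row (h261 i hMLi) (hrd i) hl hi w lam y y'
    hfirst hlam).trans ?_
  refine mul_le_mul_of_nonneg_right (mul_le_mul_of_nonneg_left (walkFactor_le_walkFactor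
    (mul_le_mul_of_nonneg_right (le_max_left _ _) hB₀.le) hcpos.le hMpos _ _) (sq_nonneg _)) ((hrd i).norm_nonneg lam)

omit [∀ i, DecidableEq (Y i)] in
/-- ★ **(OVER THE DIRECTION LETTERS.) COROLLARY 3.8 AS THE WHOLE PRINTED LEAF, RELATIVE READING CLAUSES**
(`B9Cor38WholeDir.cor38Printed_of_local342₂` with `hrd : ∀ i, (rd i).OKRel (𝔬 i).blk (Rel i)`): at `W38OfOpsDir (𝔬 i) (𝔡 i) (𝔩 i)
(rd i) (R i) (H i) C δ` from `Local342 ∧ DirSupSq37 ∧ Identities₂`, the static data, the sizes, (2.61), `LocalityDir`; O(1) :=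
max(m, 1)·B₀, everything else as the strict leaf.  Nothing of print asserted; NOT a node discharge.
[cite: Balaban1985BackgroundPropagators, Cor. 3.8 (3.93)–(3.94) p.410 + Cor. 3.6 p.408; Balaban1984PropagatorsII, Lemma 2.1 (2.61) p.234 + (2.51)–(2.52) p.232] -/
theorem cor38Printed_of_local342₂_okRel (𝔬 : ∀ i, Ops (geo i) (bg i) (X i) (Y i) (ι i))
    (𝔡 : ∀ i, DirOps37 (𝔬 i) (Dir i)) (𝔩 : ∀ i, DirLetters37 (𝔬 i) (Dir i))
    (rd : ∀ i, WalkReading (geo i) (bg i) (X i) (ι i)) (R : I → ℝ) (H : I → Prop) (κ : I → Sizes) (C δ : ℝ)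
    (d : ℕ) (α ρ N N' Cℓ K θ₀ B₀ δ₀ a₁ M₁ ML : ℝ)
    (Rel : ∀ i, (geo i).Site → (geo i).Site → Prop) [∀ i, DecidableRel (Rel i)] (m : ℕ)
    (hRd₂ : ∀ i (a b b' : (geo i).Site), Rel i b b' → (geo i).dist a b = (geo i).dist a b')
    (hmult : ∀ i (y' : (geo i).Site), (Finset.univ.filter (fun y'' => Rel i y'' y')).card ≤ m)
    (hc : 0 < c35) (hα : 0 ≤ α) (hα1 : α < 1) (hθ₀ : 0 ≤ θ₀) (hB₀ : 0 < B₀) (hδ₀ : 0 < δ₀) (ha₁ : 0 < a₁)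
    (hM₁ : 0 < M₁)
    (hst : ∀ i, StaticOK (𝔬 i) ρ N N' Cℓ (κ i)) (hκ : ∀ i, (κ i).Bounded K θ₀ Cℓ (geo i).M)
    (hrd : ∀ i, (rd i).OKRel (𝔬 i).blk (Rel i)) (hloc : ∀ i, LocalityDir (𝔬 i) (𝔡 i) (𝔩 i) (rd i))
    (h261 : ∀ i, ML ≤ (geo i).M → Ineq261 d (toB6 (geo i) (R i) (H i)) δ₀ α)
    (h36 : ∀ i, M₁ ≤ (geo i).M → ∀ α₀ : ℝ, 0 < α₀ → c35 * (geo i).M * α₀ ≤ a₁ →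
      ∀ U : (bg i).Cfg, (bg i).Reg335 c35 α₀ U →
        Local342 (𝔬 i) (R i) (H i) B₀ δ₀ U ∧ DirSupSq37 (𝔬 i) (𝔡 i) (R i) (H i) U ∧
          Identities₂ (𝔬 i) (𝔡 i) (𝔩 i) (R i) (H i) U) :
    B9.Cor38Printed c35 geo bg (fun i => W38OfOpsDir (𝔬 i) (𝔡 i) (𝔩 i) (rd i) (R i) (H i) C δ) := by
  have hcpos : 0 < B₀ * Real.exp (δ₀ * ρ) * θ₀ * B6.c1 d δ₀ α + 1 := by
    have h0 : 0 ≤ B₀ * Real.exp (δ₀ * ρ) * θ₀ * B6.c1 d δ₀ α :=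
      mul_nonneg (mul_nonneg (mul_nonneg hB₀.le (Real.exp_nonneg _)) hθ₀) (c1_nonneg d δ₀ α)
    linarith
  have hmax : 0 < max (m : ℝ) 1 * B₀ := mul_pos (lt_of_lt_of_le one_pos (le_max_right _ _)) hB₀
  refine ⟨max M₁ ML, a₁ / c35, 2 * ((1 - α) * δ₀), max (m : ℝ) 1 * B₀, B₀ * Real.exp (δ₀ * ρ) * θ₀ * B6.c1 d δ₀ α + 1,
    lt_max_of_lt_left hM₁, div_pos ha₁ hc, by nlinarith, hmax, hcpos, ?_⟩
  intro i hM α₀ hα₀ hMa U hU w lam y y' hfirst _hlast hlam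
  have hM₁i : M₁ ≤ (geo i).M := le_trans (le_max_left _ _) hM
  have hMLi : ML ≤ (geo i).M := le_trans (le_max_right _ _) hM
  have hMpos : 0 < (geo i).M := lt_of_lt_of_le hM₁ hM₁i
  have ha : c35 * (geo i).M * α₀ ≤ a₁ := by
    have h1 : (geo i).M * α₀ * c35 ≤ a₁ := (le_div_iff₀ hc).mp hMa
    calc c35 * (geo i).M * α₀ = (geo i).M * α₀ * c35 := by ring
      _ ≤ a₁ := h1
  obtain ⟨hl, hT, hi⟩ := h36 i hM₁i α₀ hα₀ ha U hU
  refine ⟨locDep_W38OfOpsDir (𝔬 i) (𝔡 i) (𝔩 i) (rd i) (R i) (H i) C δ (hloc i) U w, ?_⟩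
  refine (term_W38OfOpsDir_le_okRel (𝔬 i) (𝔡 i) (𝔩 i) (rd i) (R i) (H i) C δ d δ₀ α ρ B₀ N N' Cℓ θ₀ (κ i) U (Rel i) m
    (hRd₂ i) (hmult i) hB₀.le hδ₀.le hα hα1.le hθ₀ hMpos (hst i) (hκ i).nonneg (hκ i).row (h261 i hMLi) (hrd i) hl hT hi
    w lam y y' hfirst hlam).trans ?_
  refine mul_le_mul_of_nonneg_right (mul_le_mul_of_nonneg_left (walkFactor_le_walkFactor
    (mul_le_mul_of_nonneg_right (le_max_left _ _) hB₀.le) hcpos.le hMpos _ _) (sq_nonneg _)) ((hrd i).norm_nonneg lam)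

omit [∀ i, Fintype (Dir i)] in
/-- ★ **ROWS t37 AND c38 AT ONE LITERAL DATUM, (2.61) SUPPLIED BY `RowSum261`, RELATIVE READING CLAUSES**
(`B9RWSums347DefiniteFaces.thm37_cor38_W38OfOps_exp261_of_rowSum261` with `hrd : ∀ i, (rd i).OKRel (𝔬 i).blk (Rel i)`): Theorem 3.7
(unchanged — it does not read the walk reading: `B9Cor38Whole.thm37Printed_W38OfOps_of_local342`) and Corollary 3.8
(`cor38Printed_of_local342_okRel`) at the SAME pinned datum `W38OfOps (𝔬 i) (rd i) (R i) (H i) (const37 (exp261 geo δ₀ α) …)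
((1 − 2α)δ₀)`. [cite: Balaban1985BackgroundPropagators, Thm 3.7 (3.90) pp.409–410 + Cor. 3.8 (3.94) p.410; Balaban1984PropagatorsII, Lemma 2.1 (2.61) p.234] -/
theorem thm37_cor38_W38OfOps_exp261_of_rowSum261_okRel (𝔬 : ∀ i, Ops (geo i) (bg i) (X i) (Y i) (ι i))
    (rd : ∀ i, WalkReading (geo i) (bg i) (X i) (ι i)) (R : I → ℝ) (H : I → Prop) (κ : I → Sizes)
    (α ρ N N' Cℓ K θ₀ B₀ δ₀ a₁ M₁ : ℝ)
    (Rel : ∀ i, (geo i).Site → (geo i).Site → Prop) [∀ i, DecidableRel (Rel i)] (m : ℕ)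
    (hRd₂ : ∀ i (a b b' : (geo i).Site), Rel i b b' → (geo i).dist a b = (geo i).dist a b')
    (hmult : ∀ i (y' : (geo i).Site), (Finset.univ.filter (fun y'' => Rel i y'' y')).card ≤ m)
    (hc : 0 < c35) (hα : 0 < α) (hα2 : α ≤ 1 / 2) (hN : 0 ≤ N) (hN' : 0 ≤ N') (hCℓ : 1 ≤ Cℓ) (hK : 0 ≤ K)
    (hθ₀ : 0 ≤ θ₀) (hB₀ : 0 < B₀) (hδ₀ : 0 < δ₀) (ha₁ : 0 < a₁) (hM₁ : 0 < M₁)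
    (hst : ∀ i, StaticOK (𝔬 i) ρ N N' Cℓ (κ i)) (hκ : ∀ i, (κ i).Bounded K θ₀ Cℓ (geo i).M)
    (hrd : ∀ i, (rd i).OKRel (𝔬 i).blk (Rel i)) (hloc : ∀ i, Locality (𝔬 i) (rd i))
    (hrow : RowSum261 geo)
    (h36 : ∀ i, M₁ ≤ (geo i).M → ∀ α₀ : ℝ, 0 < α₀ → c35 * (geo i).M * α₀ ≤ a₁ →
      ∀ U : (bg i).Cfg, (bg i).Reg335 c35 α₀ U →
        Local342 (𝔬 i) (R i) (H i) B₀ δ₀ U ∧ Identities (𝔬 i) (R i) (H i) U) :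
    B9.Thm37Printed c35 geo bg
        (fun i => W38OfOps (𝔬 i) (rd i) (R i) (H i) (const37 (exp261 geo δ₀ α) δ₀ α ρ B₀ N N' Cℓ K)
          ((1 - 2 * α) * δ₀)) ∧
      B9.Cor38Printed c35 geo bg
        (fun i => W38OfOps (𝔬 i) (rd i) (R i) (H i) (const37 (exp261 geo δ₀ α) δ₀ α ρ B₀ N N' Cℓ K)
          ((1 - 2 * α) * δ₀)) := by
  obtain ⟨ML, h261⟩ := ineq261_exp261_of_rowSum261 (geo := geo) R H (mul_pos hα hδ₀) hrow
  exact ⟨thm37Printed_W38OfOps_of_local342 𝔬 rd R H κ _ α ρ N N' Cℓ K θ₀ B₀ δ₀ a₁ M₁ ML hc hα.le hα2 hN hN' hCℓ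
      hK hB₀.le hδ₀.le ha₁ hM₁ hst hκ h261 h36,
    cor38Printed_of_local342_okRel 𝔬 rd R H κ _ _ _ α ρ N N' Cℓ K θ₀ B₀ δ₀ a₁ M₁ ML Rel m hRd₂ hmult hc hα.le
      (by linarith) hθ₀ hB₀ hδ₀ ha₁ hM₁ hst hκ hrd hloc h261 h36⟩

/-- ★ **(OVER THE DIRECTION LETTERS.) ROWS t37 AND c38 AT ONE LITERAL DATUM, (2.61) SUPPLIED BY `RowSum261`, RELATIVE READING
CLAUSES** (`B9Cor38WholeDir.thm37_cor38_W38OfOps_exp261_of_rowSum261₂` with `hrd : ∀ i, (rd i).OKRel (𝔬 i).blk (Rel i)`).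
[cite: Balaban1985BackgroundPropagators, Thm 3.7 (3.90) pp.409–410 + Cor. 3.8 (3.94) p.410; Balaban1984PropagatorsII, Lemma 2.1 (2.61) p.234] -/
theorem thm37_cor38_W38OfOps_exp261_of_rowSum261₂_okRel (𝔬 : ∀ i, Ops (geo i) (bg i) (X i) (Y i) (ι i))
    (𝔡 : ∀ i, DirOps37 (𝔬 i) (Dir i)) (𝔩 : ∀ i, DirLetters37 (𝔬 i) (Dir i))
    (rd : ∀ i, WalkReading (geo i) (bg i) (X i) (ι i)) (R : I → ℝ) (H : I → Prop) (κ : I → Sizes)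
    (α ρ N N' Cℓ K θ₀ B₀ δ₀ a₁ M₁ : ℝ)
    (Rel : ∀ i, (geo i).Site → (geo i).Site → Prop) [∀ i, DecidableRel (Rel i)] (m : ℕ)
    (hRd₂ : ∀ i (a b b' : (geo i).Site), Rel i b b' → (geo i).dist a b = (geo i).dist a b')
    (hmult : ∀ i (y' : (geo i).Site), (Finset.univ.filter (fun y'' => Rel i y'' y')).card ≤ m)
    (hc : 0 < c35) (hα : 0 < α) (hα2 : α ≤ 1 / 2) (hN : 0 ≤ N) (hN' : 0 ≤ N') (hCℓ : 1 ≤ Cℓ) (hK : 0 ≤ K)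
    (hθ₀ : 0 ≤ θ₀) (hB₀ : 0 < B₀) (hδ₀ : 0 < δ₀) (ha₁ : 0 < a₁) (hM₁ : 0 < M₁)
    (hst : ∀ i, StaticOK (𝔬 i) ρ N N' Cℓ (κ i)) (hκ : ∀ i, (κ i).Bounded K θ₀ Cℓ (geo i).M)
    (hrd : ∀ i, (rd i).OKRel (𝔬 i).blk (Rel i)) (hloc : ∀ i, LocalityDir (𝔬 i) (𝔡 i) (𝔩 i) (rd i))
    (hrow : RowSum261 geo)
    (h36 : ∀ i, M₁ ≤ (geo i).M → ∀ α₀ : ℝ, 0 < α₀ → c35 * (geo i).M * α₀ ≤ a₁ →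
      ∀ U : (bg i).Cfg, (bg i).Reg335 c35 α₀ U →
        Local342 (𝔬 i) (R i) (H i) B₀ δ₀ U ∧ DirSupSq37 (𝔬 i) (𝔡 i) (R i) (H i) U ∧
          Identities₂ (𝔬 i) (𝔡 i) (𝔩 i) (R i) (H i) U) :
    B9.Thm37Printed c35 geo bg
        (fun i => W38OfOpsDir (𝔬 i) (𝔡 i) (𝔩 i) (rd i) (R i) (H i) (const37 (exp261 geo δ₀ α) δ₀ α ρ B₀ N N' Cℓ K)
          ((1 - 2 * α) * δ₀)) ∧
      B9.Cor38Printed c35 geo bg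
        (fun i => W38OfOpsDir (𝔬 i) (𝔡 i) (𝔩 i) (rd i) (R i) (H i) (const37 (exp261 geo δ₀ α) δ₀ α ρ B₀ N N' Cℓ K)
          ((1 - 2 * α) * δ₀)) := by
  obtain ⟨ML, h261⟩ := ineq261_exp261_of_rowSum261 (geo := geo) R H (mul_pos hα hδ₀) hrow
  exact ⟨thm37Printed_W38OfOps_of_local342₂ 𝔬 𝔡 𝔩 rd R H κ _ α ρ N N' Cℓ K θ₀ B₀ δ₀ a₁ M₁ ML hc hα.le hα2 hN hN' hCℓ
      hK hB₀.le hδ₀.le ha₁ hM₁ hst hκ h261 h36,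
    cor38Printed_of_local342₂_okRel 𝔬 𝔡 𝔩 rd R H κ _ _ _ α ρ N N' Cℓ K θ₀ B₀ δ₀ a₁ M₁ ML Rel m hRd₂ hmult hc hα.le
      (by linarith) hθ₀ hB₀ hδ₀ ha₁ hM₁ hst hκ hrd hloc h261 h36⟩

end Family

/-! ## §3 Row 13 (t37 ∧ c38) at the record geometry `geo9Y`, relative reading clauses, NO (2.61) binder -/

section FacesY

variable {d ℓ : ℕ} {hd : 1 ≤ d + 1} {hL : Odd (ℓ + 1) ∧ 1 < ℓ + 1} {b₀ b₁ : ℝ} {Mstar : ℕ}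
variable [∀ x : MemberY d ℓ hd hL b₀ b₁ Mstar, Fintype (geo9Y x).Site]
  [∀ x : MemberY d ℓ hd hL b₀ b₁ Mstar, DecidableEq (geo9Y x).Site]
variable {c35 : ℝ} {bg : MemberY d ℓ hd hL b₀ b₁ Mstar → B9.Backgrounds}
variable {X Y ι Dir : MemberY d ℓ hd hL b₀ b₁ Mstar → Type} [∀ x, Fintype (X x)] [∀ x, DecidableEq (X x)]
  [∀ x, Fintype (Y x)] [∀ x, DecidableEq (Y x)] [∀ x, Fintype (ι x)] [∀ x, Fintype (Dir x)]

omit [∀ x, Fintype (Dir x)] in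
/-- ★ **ROW 13 (t37 ∧ c38) AT THE RECORD GEOMETRY WITH NO (2.61) BINDER, RELATIVE READING CLAUSES**
(`B9RWSums347DefiniteFaces.thm37_cor38_W38OfOps_exp261_geo9Y` with `hrd : ∀ x, (rd x).OKRel (𝔬 x).blk (Rel x)`): Theorem 3.7 and
Corollary 3.8 at the literal datum `W38OfOps (𝔬 x) (rd x) (R x) (H x) (const37 (exp261 geo9Y δ₀ α) …) ((1 − 2α)δ₀)` over def-Y's
members — (2.61) from `rowSum261_geo9Y` BY NAME. [cite: Balaban1985BackgroundPropagators, Thm 3.7 (3.90) pp.409–410 + Cor. 3.8 (3.94) p.410; Balaban1984PropagatorsII, Lemma 2.1 (2.61) p.234] -/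
theorem thm37_cor38_W38OfOps_exp261_geo9Y_okRel
    (𝔬 : ∀ x : MemberY d ℓ hd hL b₀ b₁ Mstar, Ops (geo9Y x) (bg x) (X x) (Y x) (ι x))
    (rd : ∀ x : MemberY d ℓ hd hL b₀ b₁ Mstar, WalkReading (geo9Y x) (bg x) (X x) (ι x))
    (R : MemberY d ℓ hd hL b₀ b₁ Mstar → ℝ) (H : MemberY d ℓ hd hL b₀ b₁ Mstar → Prop)
    (κ : MemberY d ℓ hd hL b₀ b₁ Mstar → Sizes) (α ρ N N' Cℓ K θ₀ B₀ δ₀ a₁ M₁ : ℝ)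
    (Rel : ∀ x : MemberY d ℓ hd hL b₀ b₁ Mstar, (geo9Y x).Site → (geo9Y x).Site → Prop) [∀ x, DecidableRel (Rel x)]
    (m : ℕ)
    (hRd₂ : ∀ x (a b b' : (geo9Y x).Site), Rel x b b' → (geo9Y x).dist a b = (geo9Y x).dist a b')
    (hmult : ∀ x (y' : (geo9Y x).Site), (Finset.univ.filter (fun y'' => Rel x y'' y')).card ≤ m)
    (hc : 0 < c35) (hα : 0 < α) (hα2 : α ≤ 1 / 2) (hN : 0 ≤ N) (hN' : 0 ≤ N') (hCℓ : 1 ≤ Cℓ) (hK : 0 ≤ K)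
    (hθ₀ : 0 ≤ θ₀) (hB₀ : 0 < B₀) (hδ₀ : 0 < δ₀) (ha₁ : 0 < a₁) (hM₁ : 0 < M₁)
    (hst : ∀ x, StaticOK (𝔬 x) ρ N N' Cℓ (κ x)) (hκ : ∀ x, (κ x).Bounded K θ₀ Cℓ (geo9Y x).M)
    (hrd : ∀ x, (rd x).OKRel (𝔬 x).blk (Rel x)) (hloc : ∀ x, Locality (𝔬 x) (rd x))
    (h36 : ∀ x, M₁ ≤ (geo9Y x).M → ∀ α₀ : ℝ, 0 < α₀ → c35 * (geo9Y x).M * α₀ ≤ a₁ →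
      ∀ U : (bg x).Cfg, (bg x).Reg335 c35 α₀ U →
        Local342 (𝔬 x) (R x) (H x) B₀ δ₀ U ∧ Identities (𝔬 x) (R x) (H x) U) :
    B9.Thm37Printed c35 geo9Y bg
        (fun x => W38OfOps (𝔬 x) (rd x) (R x) (H x)
          (const37 (exp261 (@geo9Y d ℓ hd hL b₀ b₁ Mstar) δ₀ α) δ₀ α ρ B₀ N N' Cℓ K) ((1 - 2 * α) * δ₀)) ∧
      B9.Cor38Printed c35 geo9Y bg
        (fun x => W38OfOps (𝔬 x) (rd x) (R x) (H x)
          (const37 (exp261 (@geo9Y d ℓ hd hL b₀ b₁ Mstar) δ₀ α) δ₀ α ρ B₀ N N' Cℓ K) ((1 - 2 * α) * δ₀)) :=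
  thm37_cor38_W38OfOps_exp261_of_rowSum261_okRel 𝔬 rd R H κ α ρ N N' Cℓ K θ₀ B₀ δ₀ a₁ M₁ Rel m hRd₂ hmult hc hα hα2 hN
    hN' hCℓ hK hθ₀ hB₀ hδ₀ ha₁ hM₁ hst hκ hrd hloc rowSum261_geo9Y h36

/-- ★ **(OVER THE DIRECTION LETTERS.) ROW 13 (t37 ∧ c38) AT THE RECORD GEOMETRY WITH NO (2.61) BINDER, RELATIVE READING CLAUSES**
(`B9Cor38WholeDir.thm37_cor38_W38OfOps_exp261_geo9Y₂` with `hrd : ∀ x, (rd x).OKRel (𝔬 x).blk (Rel x)`).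
[cite: Balaban1985BackgroundPropagators, Thm 3.7 (3.90) pp.409–410 + Cor. 3.8 (3.94) p.410; Balaban1984PropagatorsII, Lemma 2.1 (2.61) p.234] -/
theorem thm37_cor38_W38OfOps_exp261_geo9Y₂_okRel
    (𝔬 : ∀ x : MemberY d ℓ hd hL b₀ b₁ Mstar, Ops (geo9Y x) (bg x) (X x) (Y x) (ι x))
    (𝔡 : ∀ x : MemberY d ℓ hd hL b₀ b₁ Mstar, DirOps37 (𝔬 x) (Dir x))
    (𝔩 : ∀ x : MemberY d ℓ hd hL b₀ b₁ Mstar, DirLetters37 (𝔬 x) (Dir x))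
    (rd : ∀ x : MemberY d ℓ hd hL b₀ b₁ Mstar, WalkReading (geo9Y x) (bg x) (X x) (ι x))
    (R : MemberY d ℓ hd hL b₀ b₁ Mstar → ℝ) (H : MemberY d ℓ hd hL b₀ b₁ Mstar → Prop)
    (κ : MemberY d ℓ hd hL b₀ b₁ Mstar → Sizes) (α ρ N N' Cℓ K θ₀ B₀ δ₀ a₁ M₁ : ℝ)
    (Rel : ∀ x : MemberY d ℓ hd hL b₀ b₁ Mstar, (geo9Y x).Site → (geo9Y x).Site → Prop) [∀ x, DecidableRel (Rel x)]
    (m : ℕ)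
    (hRd₂ : ∀ x (a b b' : (geo9Y x).Site), Rel x b b' → (geo9Y x).dist a b = (geo9Y x).dist a b')
    (hmult : ∀ x (y' : (geo9Y x).Site), (Finset.univ.filter (fun y'' => Rel x y'' y')).card ≤ m)
    (hc : 0 < c35) (hα : 0 < α) (hα2 : α ≤ 1 / 2) (hN : 0 ≤ N) (hN' : 0 ≤ N') (hCℓ : 1 ≤ Cℓ) (hK : 0 ≤ K)
    (hθ₀ : 0 ≤ θ₀) (hB₀ : 0 < B₀) (hδ₀ : 0 < δ₀) (ha₁ : 0 < a₁) (hM₁ : 0 < M₁)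
    (hst : ∀ x, StaticOK (𝔬 x) ρ N N' Cℓ (κ x)) (hκ : ∀ x, (κ x).Bounded K θ₀ Cℓ (geo9Y x).M)
    (hrd : ∀ x, (rd x).OKRel (𝔬 x).blk (Rel x)) (hloc : ∀ x, LocalityDir (𝔬 x) (𝔡 x) (𝔩 x) (rd x))
    (h36 : ∀ x, M₁ ≤ (geo9Y x).M → ∀ α₀ : ℝ, 0 < α₀ → c35 * (geo9Y x).M * α₀ ≤ a₁ →
      ∀ U : (bg x).Cfg, (bg x).Reg335 c35 α₀ U →
        Local342 (𝔬 x) (R x) (H x) B₀ δ₀ U ∧ DirSupSq37 (𝔬 x) (𝔡 x) (R x) (H x) U ∧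
          Identities₂ (𝔬 x) (𝔡 x) (𝔩 x) (R x) (H x) U) :
    B9.Thm37Printed c35 geo9Y bg
        (fun x => W38OfOpsDir (𝔬 x) (𝔡 x) (𝔩 x) (rd x) (R x) (H x)
          (const37 (exp261 (@geo9Y d ℓ hd hL b₀ b₁ Mstar) δ₀ α) δ₀ α ρ B₀ N N' Cℓ K) ((1 - 2 * α) * δ₀)) ∧
      B9.Cor38Printed c35 geo9Y bg
        (fun x => W38OfOpsDir (𝔬 x) (𝔡 x) (𝔩 x) (rd x) (R x) (H x)
          (const37 (exp261 (@geo9Y d ℓ hd hL b₀ b₁ Mstar) δ₀ α) δ₀ α ρ B₀ N N' Cℓ K) ((1 - 2 * α) * δ₀)) :=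
  thm37_cor38_W38OfOps_exp261_of_rowSum261₂_okRel 𝔬 𝔡 𝔩 rd R H κ α ρ N N' Cℓ K θ₀ B₀ δ₀ a₁ M₁ Rel m hRd₂ hmult hc hα hα2
    hN hN' hCℓ hK hθ₀ hB₀ hδ₀ ha₁ hM₁ hst hκ hrd hloc rowSum261_geo9Y h36

end FacesY

end

end Literature.MathematicalPhysics.QuantumFieldTheory.Balaban1983to89.B9Cor38WholeRelFaces
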